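import Summits.Ventures.QEDPrecision.Diagrams.VolkovOnShellSetsOrder10C131Rigid

/-!
Venture QEDPrecision / cell `pub-qed`, unit `pub-qed-int-2` (INT-2, gen 9). HONEST FRAMING: independent recomputation; certified
where stated, statistical where stated; no new-physics claim.  NEW WORK of the cell (a kernel-checked formal identity in the
unit's OWN model), not a published result: nothing here is cited as a fact anywhere; the printed sources are named only in
comments.
Staged copy: HOME/lean/int2/VolkovOnShellSetsOrder10C131RigidFinal.lean (declarations byte-identical).

# Five loops: the class (1;3,1) admits NO proper non-empty closing subset — final part (groups 1–4, the column table, rigidity)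

Finishes the chain of `VolkovOnShellSetsOrder10C131Rigid`: column tables for groups 1–4; `class131_columns` — the column table
of the certificate monomials over all 148 rows (as `perm131`) is the literal one; `class131_rigid` — forcing along those
columns, from single rows, ends with ONE class.  With `class131_closes` (`…C131ClosesFinal`; side by side in
`…C131Indivisible`): in the unit's formal Ward-identity model the class (1;3,1) closes and no proper non-empty subset of it
closes (soundness of forcing: `VolkovOnShellSetsGrouped`, `VolkovOnShellSetsMinimal`).  NOT CLAIMED: as in
`VolkovOnShellSetsOrder10C122`.
-/

-- One kernel certificate at a time: each chunk theorem below is sized for ONE kernel evaluation; sequential elaboration keeps the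
-- process within the farm's memory cap (same device as the `MatrixMultiplication` certificate files).
set_option Elab.async false

namespace Summit.Ventures.QEDPrecision.Diagrams

set_option maxHeartbeats 4000000 in
set_option maxRecDepth 40000 in
/-- column table of the groups 4–8. -/
theorem cols131_s4 : colTable 5 rows131 keys131 s131_3 = cols131 s131_3 := by
  rw [s131_3, colTable_append, cols131_s5]
  decide +kernel

set_option maxHeartbeats 4000000 in
set_option maxRecDepth 40000 in
/-- column table of the groups 3–8. -/
theorem cols131_s3 : colTable 5 rows131 keys131 s131_2 = cols131 s131_2 := by
  rw [s131_2, colTable_append, cols131_s4]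
  decide +kernel

set_option maxHeartbeats 4000000 in
set_option maxRecDepth 40000 in
/-- column table of the groups 2–8. -/
theorem cols131_s2 : colTable 5 rows131 keys131 s131_1 = cols131 s131_1 := by
  rw [s131_1, colTable_append, cols131_s3]
  decide +kernel

set_option maxHeartbeats 4000000 in
set_option maxRecDepth 40000 in
/-- column table of the groups 1–8. -/
theorem cols131_s1 : colTable 5 rows131 keys131 s131_0 = cols131 s131_0 := by
  rw [s131_0, colTable_append, cols131_s2]
  decide +kernel

set_option maxHeartbeats 4000000 in
set_option maxRecDepth 40000 in
/-- the column table of the certificate monomials over the whole class is the literal one. -/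
theorem class131_columns : colTable 5 rows131 keys131 perm131 = cert131.map (fun mc => mc.2) := by
  unfold perm131
  rw [cols131_s1]
  decide +kernel

set_option maxHeartbeats 4000000 in
set_option maxRecDepth 40000 in
/-- RIGIDITY: forcing along the certified columns ends with one class. -/
theorem class131_rigid : rigidCols perm131 (cert131.map (fun mc => mc.2)) = true := by
  decide +kernel

end Summit.Ventures.QEDPrecision.Diagrams
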